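import Literature.ModelTheory.ExponentialFields.PilaWilkieUnaryParametrization
import HarnessLib

/-!
# Tools for the higher-dimensional parametrization (Pila–Wilkie 2006, §§4–5): the `1`-cube plumbing and a definable selector for compact sets

Topic `Literature/ModelTheory/ExponentialFields`; proof file in the cone of the named fact
`PilaWilkie2006_thm_1_8`, continuing `PilaWilkieUnaryParametrizationCr.lean` and
`PilaWilkieParametrizationLimits.lean`.

* `contDiffOn_norm_iteratedFDeriv_le_of_unary` — a `C^r` function on `(0,1)` with
  `|f^{(q)}| ≤ 1` (`q ≤ r`, derivatives within `(0,1)`) is, read as a map on the open `1`-cube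
  `(0,1)^1`, of class `C^r` with `‖D^q‖ ≤ 1` — the form of the hypotheses of
  `PilaWilkie2006_prop_6_1` (`k = 1`), so that `uniform_r_parametrization` feeds the counting.
* `exists_definableMap_mem_of_isCompact` — **a definable selector for the compact non-empty
  members of a definable family of subsets of `ℝ^k`** (the lexicographic minimum, by induction
  on `k`: the least first coordinate is an attained infimum, definable by `definableFun_sInf`).
  This replaces the appeal to definable Skolem functions in the proof of Pila–Wilkie 2006,
  Lemma 4.2 (*"Since `M` admits definable Skolem functions it follows that `s` may be taken to
  be a definable function in both `t` and `y`"*) — there the selection is from the compact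
  argmax set of a continuous definable function.

Nothing here is a named fact; no definitions.

## References

* J. Pila, A. J. Wilkie, *The rational points of a definable set*, Duke Math. J. 133 (2006),
  §4 (Lemma 4.2), §6 (Prop. 6.1). [PilaWilkie2006]
-/

noncomputable section

open Set FirstOrder FirstOrder.Language Filter Topology

namespace Literature.ModelTheory.ExponentialFields

/-! ### Plumbing: unary functions as maps on the open `1`-cube -/

section Plumbing

/-- The open `1`-cube is the preimage of `(0,1)` under evaluation at `0`. [folklore] -/
theorem pi_Ioo_fin_one_eq_preimage :
    (Set.pi Set.univ fun _ : Fin 1 => Ioo (0 : ℝ) 1) =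
      (ContinuousLinearMap.proj (R := ℝ) (0 : Fin 1) : (Fin 1 → ℝ) →L[ℝ] ℝ) ⁻¹' Ioo 0 1 := by
  ext x
  simp only [Set.mem_pi, Set.mem_univ, forall_const, mem_preimage, ContinuousLinearMap.proj_apply]
  constructor
  · intro h; exact h 0
  · intro h i; rw [Fin.eq_zero i]; exact h

/-- **A `C^r` function on `(0,1)` with `|f^{(q)}| ≤ 1` is, as a map on the open `1`-cube, `C^r`
with `‖D^q‖ ≤ 1`** (the form of the hypotheses of `PilaWilkie2006_prop_6_1` for `k = 1`).
[folklore] -/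
theorem contDiffOn_norm_iteratedFDeriv_le_of_unary {f : ℝ → ℝ} {r : ℕ}
    (hf : ContDiffOn ℝ r f (Ioo 0 1))
    (hb : ∀ q ≤ r, ∀ y ∈ Ioo (0 : ℝ) 1, |iteratedDerivWithin q f (Ioo 0 1) y| ≤ 1) :
    ContDiffOn ℝ r (fun x : Fin 1 → ℝ => f (x 0)) (Set.pi Set.univ fun _ : Fin 1 => Ioo (0 : ℝ) 1) ∧
      ∀ q ≤ r, ∀ x ∈ Set.pi Set.univ (fun _ : Fin 1 => Ioo (0 : ℝ) 1),
        ‖iteratedFDeriv ℝ q (fun x : Fin 1 → ℝ => f (x 0)) x‖ ≤ 1 := by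
  set g : (Fin 1 → ℝ) →L[ℝ] ℝ := ContinuousLinearMap.proj (R := ℝ) (0 : Fin 1) with hg
  have hcube := pi_Ioo_fin_one_eq_preimage
  have hcomp : (fun x : Fin 1 → ℝ => f (x 0)) = f ∘ g := rfl
  have hopen : IsOpen (Set.pi Set.univ fun _ : Fin 1 => Ioo (0 : ℝ) 1) :=
    isOpen_set_pi finite_univ fun _ _ => isOpen_Ioo
  have hCr : ContDiffOn ℝ r (fun x : Fin 1 → ℝ => f (x 0)) (Set.pi Set.univ fun _ : Fin 1 => Ioo (0 : ℝ) 1) := by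
    rw [hcomp, hcube]
    exact hf.comp g.contDiff.contDiffOn fun x hx => hx
  refine ⟨hCr, fun q hq x hx => ?_⟩
  have hx0 : x 0 ∈ Ioo (0 : ℝ) 1 := hx 0 (mem_univ _)
  have hgn : ‖g‖ ≤ 1 := by
    refine ContinuousLinearMap.opNorm_le_bound _ zero_le_one fun y => ?_
    rw [one_mul]
    exact norm_le_pi_norm y 0
  rw [← iteratedFDerivWithin_of_isOpen q hopen hx, hcomp, hcube]
  rw [hcube] at hx
  have h := g.iteratedFDerivWithin_comp_right hf (uniqueDiffOn_Ioo 0 1)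
    (by rw [← hcube]; exact hopen.uniqueDiffOn) hx (i := q) (by exact_mod_cast hq)
  rw [h]
  calc ‖(iteratedFDerivWithin ℝ q f (Ioo 0 1) (g x)).compContinuousLinearMap fun _ => g‖
      ≤ ‖iteratedFDerivWithin ℝ q f (Ioo 0 1) (g x)‖ * ∏ _i : Fin q, ‖g‖ :=
        ContinuousMultilinearMap.norm_compContinuousLinearMap_le _ _
    _ ≤ 1 * 1 := by
        gcongr
        · rw [norm_iteratedFDerivWithin_eq_norm_iteratedDerivWithin, Real.norm_eq_abs]
          exact hb q hq _ hx0
        · exact Finset.prod_le_one (fun _ _ => norm_nonneg _) fun _ _ => hgn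
    _ = 1 := one_mul 1

end Plumbing


/-! ### Definable selection of a point in compact members of a definable family (lexicographic minimum) -/

section LexMin

variable {L : Language} [L.Structure ℝ]

/-- **Definable choice without choice, for compact sets**: for a definable family of subsets
`S_v = {z | (v, z) ∈ S} ⊆ ℝ^k` there is a definable map `sel` with `sel v ∈ S_v` whenever `S_v`
is compact and non-empty (the lexicographic minimum: least first coordinate — an infimum
attained by compactness, definable by `definableFun_sInf` — then recursively in the slice).
This replaces the definable Skolem functions of Pila–Wilkie 2006, proof of Lemma 4.2 (*"Since
`M` admits definable Skolem functions it follows that `s` may be taken to be a definable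
function in both `t` and `y`"*), where the selection is from a compact argmax set. [folklore] -/
theorem exists_definableMap_mem_of_isCompact
    (hadd : (univ : Set ℝ).Definable L {v : Fin 3 → ℝ | v 0 + v 1 = v 2})
    (hmul : (univ : Set ℝ).Definable L {v : Fin 3 → ℝ | v 0 * v 1 = v 2}) (k : ℕ) :
    ∀ {β : Type} [Finite β] (S : Set (β ⊕ Fin k → ℝ)), (univ : Set ℝ).Definable L S →
      ∃ sel : (β → ℝ) → (Fin k → ℝ), (univ : Set ℝ).DefinableMap L sel ∧
        ∀ v : β → ℝ, IsCompact {z : Fin k → ℝ | Sum.elim v z ∈ S} →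
          {z : Fin k → ℝ | Sum.elim v z ∈ S}.Nonempty → Sum.elim v (sel v) ∈ S := by
  induction k with
  | zero =>
    intro β _ S _
    refine ⟨fun _ => Fin.elim0, fun i => i.elim0, fun v _ hne => ?_⟩
    obtain ⟨z, hz⟩ := hne
    have : z = Fin.elim0 := funext fun i => i.elim0
    rw [← this]; exact hz
  | succ k ih =>
    intro β _ S hS
    -- (1) the first coordinate `a v = inf {z 0 | (v, z) ∈ S}`
    set a : (β → ℝ) → ℝ := fun v => sInf {y | ∃ z : Fin (k + 1) → ℝ, Sum.elim v z ∈ S ∧ z 0 = y} with ha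
    -- index maps
    set σ₁ : β ⊕ Fin (k + 1) → (β ⊕ Unit) ⊕ Fin (k + 1) :=
      Sum.elim (fun b => Sum.inl (Sum.inl b)) (fun i => Sum.inr i) with hσ₁
    have hA : (univ : Set ℝ).Definable L
        ({u : (β ⊕ Unit) ⊕ Fin (k + 1) → ℝ | u ∘ σ₁ ∈ S} ∩ {u | u (Sum.inr 0) = u (Sum.inl (Sum.inr ()))}) :=
      (hS.preimage_comp σ₁).inter (definable_setOf_eq' (definableFun_proj _) (definableFun_proj _))
    have hAimg := hA.image_comp (Sum.inl : β ⊕ Unit → (β ⊕ Unit) ⊕ Fin (k + 1))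
    have hWeq : {w : β ⊕ Unit → ℝ | ∃ z : Fin (k + 1) → ℝ,
        Sum.elim (fun i => w (Sum.inl i)) z ∈ S ∧ z 0 = w (Sum.inr ())} =
        (fun u : (β ⊕ Unit) ⊕ Fin (k + 1) → ℝ => u ∘ Sum.inl) ''
          ({u | u ∘ σ₁ ∈ S} ∩ {u | u (Sum.inr 0) = u (Sum.inl (Sum.inr ()))}) := by
      ext w
      simp only [mem_setOf_eq, mem_image, mem_inter_iff]
      constructor
      · rintro ⟨z, hzS, hz0⟩
        refine ⟨Sum.elim w z, ⟨?_, ?_⟩, ?_⟩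
        · have : (Sum.elim w z) ∘ σ₁ = Sum.elim (fun i => w (Sum.inl i)) z := by
            funext i; cases i <;> rfl
          rw [this]; exact hzS
        · simpa using hz0
        · funext i; rfl
      · rintro ⟨u, ⟨huS, hu0⟩, rfl⟩
        refine ⟨fun i => u (Sum.inr i), ?_, ?_⟩
        · have : u ∘ σ₁ = Sum.elim (fun i => (u ∘ Sum.inl) (Sum.inl i)) (fun i => u (Sum.inr i)) := by
            funext i; cases i <;> rfl
          rw [← this]; exact huS
        · simpa using hu0
    have haDef : (univ : Set ℝ).DefinableFun L a := by
      refine definableFun_sInf hadd hmul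
        (W := fun v y => ∃ z : Fin (k + 1) → ℝ, Sum.elim v z ∈ S ∧ z 0 = y) ?_
      rw [hWeq]; exact hAimg
    -- (2) the slice family over `β ⊕ Unit` (parameters `v` and the value used for the first coordinate)
    set σ₂ : β ⊕ Fin (k + 1) → (β ⊕ Unit) ⊕ Fin k := fun i =>
      Sum.elim (fun b => (Sum.inl (Sum.inl b) : (β ⊕ Unit) ⊕ Fin k))
        (fun j => Fin.cases (Sum.inl (Sum.inr ())) (fun j' => Sum.inr j') j) i with hσ₂
    set S' : Set ((β ⊕ Unit) ⊕ Fin k → ℝ) := {w | w ∘ σ₂ ∈ S} with hS'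
    have hS'def : (univ : Set ℝ).Definable L S' := hS.preimage_comp σ₂
    obtain ⟨sel', hsel'def, hsel'⟩ := ih S' hS'def
    -- the key identity: `Sum.elim (Sum.elim v (fun _ => c)) w ∘ σ₂ = Sum.elim v (Fin.cons c w)`
    have hkey : ∀ (v : β → ℝ) (c : ℝ) (w : Fin k → ℝ),
        (Sum.elim (Sum.elim v (fun _ => c)) w : (β ⊕ Unit) ⊕ Fin k → ℝ) ∘ σ₂ =
          Sum.elim v (Fin.cons c w : Fin (k + 1) → ℝ) := by
      intro v c w
      funext i
      cases i with
      | inl b => rfl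
      | inr j => refine Fin.cases ?_ (fun j' => ?_) j <;> rfl
    -- (3) assemble `sel v = (a v, sel' (v, a v))`
    have hq : (univ : Set ℝ).DefinableMap L (fun v : β → ℝ => (Sum.elim v (fun _ => a v) : β ⊕ Unit → ℝ)) := by
      intro x
      cases x with
      | inl b => exact definableFun_proj _
      | inr _ => exact haDef
    refine ⟨fun v => Fin.cons (a v) (sel' (Sum.elim v (fun _ => a v))), fun i => ?_, fun v hcomp hne => ?_⟩
    · refine Fin.cases ?_ (fun j => ?_) i
      · simpa using haDef
      · simp only [Fin.cons_succ]
        exact (hsel'def j).comp hq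
    · -- membership
      set T := {z : Fin (k + 1) → ℝ | Sum.elim v z ∈ S} with hT
      have himg : {y | ∃ z : Fin (k + 1) → ℝ, Sum.elim v z ∈ S ∧ z 0 = y} = (fun z => z 0) '' T := by
        ext y; simp [hT]
      have hTc : IsCompact ((fun z : Fin (k + 1) → ℝ => z 0) '' T) := hcomp.image (continuous_apply 0)
      have hmem : a v ∈ (fun z : Fin (k + 1) → ℝ => z 0) '' T := by
        have : a v = sInf ((fun z : Fin (k + 1) → ℝ => z 0) '' T) := by rw [ha]; simp only []; rw [himg]
        rw [this]
        exact hTc.sInf_mem (hne.image _)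
      obtain ⟨z₀, hz₀, hz₀a⟩ := hmem
      -- the slice `{w | (a v, w) ∈ T}` is compact and non-empty
      have hslice : {w : Fin k → ℝ | Sum.elim (Sum.elim v (fun _ => a v)) w ∈ S'} =
          {w : Fin k → ℝ | (Fin.cons (a v) w : Fin (k + 1) → ℝ) ∈ T} := by
        ext w
        simp only [hS', hT, mem_setOf_eq, hkey]
      have hsc : IsCompact {w : Fin k → ℝ | (Fin.cons (a v) w : Fin (k + 1) → ℝ) ∈ T} := by
        have heq : {w : Fin k → ℝ | (Fin.cons (a v) w : Fin (k + 1) → ℝ) ∈ T} =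
            Fin.tail '' (T ∩ {z | z 0 = a v}) := by
          ext w
          simp only [mem_setOf_eq, mem_image, mem_inter_iff]
          constructor
          · intro hw
            exact ⟨Fin.cons (a v) w, ⟨hw, by simp⟩, by simp⟩
          · rintro ⟨z, ⟨hz, hz0⟩, rfl⟩
            have : (Fin.cons (a v) (Fin.tail z) : Fin (k + 1) → ℝ) = z := by
              rw [← hz0]; exact Fin.cons_self_tail z
            rw [this]; exact hz
        rw [heq]
        exact (hcomp.inter_right (isClosed_eq (continuous_apply 0) continuous_const)).image
          (continuous_pi fun i => continuous_apply _)
      have hsne : {w : Fin k → ℝ | (Fin.cons (a v) w : Fin (k + 1) → ℝ) ∈ T}.Nonempty := by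
        refine ⟨Fin.tail z₀, ?_⟩
        show (Fin.cons (a v) (Fin.tail z₀) : Fin (k + 1) → ℝ) ∈ T
        rw [← hz₀a, Fin.cons_self_tail]; exact hz₀
      have h := hsel' (Sum.elim v (fun _ => a v)) (hslice ▸ hsc) (hslice ▸ hsne)
      -- `h : Sum.elim (Sum.elim v _) (sel' _) ∈ S'`, i.e. `Sum.elim v (Fin.cons (a v) (sel' _)) ∈ S`
      have h' : (Sum.elim (Sum.elim v (fun _ => a v)) (sel' (Sum.elim v (fun _ => a v))) :
          (β ⊕ Unit) ⊕ Fin k → ℝ) ∘ σ₂ ∈ S := h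
      rwa [hkey] at h'

end LexMin


end Literature.ModelTheory.ExponentialFields

end
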